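import Literature.AlgebraicGeometry.Motives.RelativeLocalCoordinates
import Literature.RingTheory.Derivation.KaehlerMapBasisDet
import HarnessLib

/-!
# The Jacobian cocycle of a rational top form under a morphism inducing an isomorphism of local
# rings is a unit at the point

Topic `Literature/AlgebraicGeometry/Motives` (proofs only; no definitions, no named facts), in the
currency of ★ `RationalTopFormFrames` / ★ `RelativeLocalCoordinates` (rational top forms
`θ = (f, u)` relative to a base ring `A`: `f ∈ K(Y)`, rational coordinates `u` with `d uᵢ` a basis
`B` of `Ω[K(Y)⁄A]`; «frame at `q`» = `RatFn.IsUnitAt q (f · W.det B)` for relative local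
coordinates `w` at `q` with function-field basis `W`).

* `det_D_ringHom_eq` — the chain rule for Jacobian determinants along a RING HOMOMORPHISM
  `σ : L → L'` over `τ : A → A'` (★ `det_D_eq_algebraMap_det_D` re-phrased without an `Algebra L L'`
  instance, so that it applies to an endomorphism `σ : K(Y) → K(Y)`);
* `isUnitAt_cocycle_of_isIso_stalkMap` — **the local heart of the `ω`-argument** (Bosch–Lütkebohmert–
  Raynaud §4.3 / Edixhoven–Romagny Thm. 6.3, «`φ^* ω' = b ω'` with `b` a unit»): let `Φ : Y → Y'`… here
  an endomorphism `Φ : Y → Y` of an integral scheme, dominant, inducing an ISOMORPHISM of local rings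
  at `q` compatible with the `A`-algebra structures (e.g. an automorphism over the base), `σ = Φ^♯` on
  `K(Y)`. If the rational top form `θ = (f, u)` is a frame at `q` AND at `Φ q`, then the cocycle
  `c = σ(f) · det_B (d σ uᵢ)ᵢ · f⁻¹` — the ratio `Φ^*θ / θ` — is a unit at `q`:
  `c = σ(f · W'.det B) · W.det W'' · (f · W.det B)⁻¹` with `W''` the coordinates at `q` transported
  from `Φ q` (★ `exists_localCoordinates_of_isIso_stalkMap`), a product of three units at `q`.

Cell `hodgecm-mathlib`, road W of `r₀` ((W0) leaf L4c-pre, local form; the global form on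
`E ⊗ E` follows by supplying relative coordinates at every point from the product chart).

## Sources

* S. Bosch, W. Lütkebohmert, M. Raynaud, *Néron Models*, Springer 1990, §4.3 (proof of Prop. 4.3/2:
  the pull-back of the invariant form under the translation is a unit multiple). [BLRNeronModels1990]
* B. Edixhoven, M. Romagny, *Group schemes out of birational group laws, Néron models*,
  arXiv:1204.1799v2, proof of Thm. 6.3. [EdixhovenRomagny2012]
-/

noncomputable section

universe u

open CategoryTheory AlgebraicGeometry Opposite

namespace Literature.AlgebraicGeometry.Motives

open RatFn Literature.RingTheory.Derivation

/-! ### Chain rule along a ring homomorphism (no `Algebra L L'` instance) -/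

/-- **Chain rule for Jacobian determinants along a ring homomorphism.** Let `A → L`, `A' → L'` be
algebras, `τ : A → A'`, `σ : L → L'` with `σ ∘ algebraMap = algebraMap ∘ τ`; let `d zᵢ` be a basis `b`
of `Ω[L⁄A]` and `d (σ zᵢ)` a basis `b'` of `Ω[L'⁄A']`. Then for every family `v`,
`b'.det (d (σ vⱼ))ⱼ = σ (b.det (d vⱼ)ⱼ)` (★ `det_D_eq_algebraMap_det_D` with the algebra structure
`σ`; stated for ring homomorphisms so that `L' = L` is allowed). [cite: BLRNeronModels1990, §2.2 Prop. 11 (proof)] -/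
theorem det_D_ringHom_eq {A A' L L' : Type u} [CommRing A] [CommRing A'] [CommRing L] [CommRing L']
    [Algebra A L] [Algebra A' L'] (τ : A →+* A') (σ : L →+* L')
    (hστ : σ.comp (algebraMap A L) = (algebraMap A' L').comp τ) {ι : Type*} [Fintype ι]
    [DecidableEq ι] {z : ι → L} (b : Module.Basis ι L Ω[L⁄A])
    (hb : ∀ i, b i = KaehlerDifferential.D A L (z i)) (b' : Module.Basis ι L' Ω[L'⁄A'])
    (hb' : ∀ i, b' i = KaehlerDifferential.D A' L' (σ (z i))) (v : ι → L) :
    b'.det (fun j => KaehlerDifferential.D A' L' (σ (v j))) =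
      σ (b.det fun j => KaehlerDifferential.D A L (v j)) := by
  letI : Algebra L L' := σ.toAlgebra
  letI : Algebra A A' := τ.toAlgebra
  letI : Algebra A L' := ((algebraMap A' L').comp τ).toAlgebra
  haveI : IsScalarTower A L L' := IsScalarTower.of_algebraMap_eq fun a =>
    (RingHom.congr_fun hστ a).symm
  haveI : IsScalarTower A A' L' := IsScalarTower.of_algebraMap_eq fun a => rfl
  haveI : SMulCommClass A' L L' := ⟨fun a l x => by
    simp only [Algebra.smul_def]
    ring⟩
  exact det_D_eq_algebraMap_det_D (R := A) (S := A') (A := L) (B := L') b b' hb hb' v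

/-! ### The cocycle at a point -/

variable {Y : Scheme.{u}} [IsIntegral Y] (Φ : Y ⟶ Y) [IsDominant Φ] (n : ℕ) (A : Type u)
  [CommRing A] (q : Y) [Algebra A (Y.presheaf.stalk q)] [Algebra A (Y.presheaf.stalk (Φ.base q))]
  [Algebra A Y.functionField] [IsScalarTower A (Y.presheaf.stalk q) Y.functionField]

/-- **The Jacobian cocycle of a top form that is a frame at `q` and at `Φ q` is a unit at `q`**, for
`Φ` inducing an isomorphism `𝒪_{Y,Φ q} ≅ 𝒪_{Y,q}` over `A` (Bosch–Lütkebohmert–Raynaud §4.3;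
Edixhoven–Romagny, proof of Thm. 6.3). Data: relative coordinates `w` at `q` (stalk basis `b`,
function-field basis `W`) and `w'` at `Φ q` (`b'`, `W'`); a rational top form `(f, u)` relative to
`A` with `d uᵢ` the basis `B` of `Ω[K(Y)⁄A]`, a frame at `q` (`IsUnitAt q (f · W.det B)`) and at
`Φ q` (`IsUnitAt (Φ q) (f · W'.det B)`). Conclusion: with `σ = Φ^♯` on `K(Y)` (`RatFn.functionFieldMap`,
an `A`-algebra map: hypothesis `hσA`), `σ f · B.det (d σ uᵢ)ᵢ · f⁻¹` is a unit at `q`.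
[cite: BLRNeronModels1990, §4.3 (Prop. 2, proof)] [cite: EdixhovenRomagny2012, Thm. 6.3 (proof)] -/
theorem isUnitAt_cocycle_of_isIso_stalkMap [IsIso (Φ.stalkMap q)]
    (hA : (Φ.stalkMap q).hom.comp (algebraMap A (Y.presheaf.stalk (Φ.base q))) =
      algebraMap A (Y.presheaf.stalk q))
    (hσA : (functionFieldMap Φ).comp (algebraMap A Y.functionField) = algebraMap A Y.functionField)
    -- relative coordinates at `q`
    {w : Fin n → Y.presheaf.stalk q}
    (b : Module.Basis (Fin n) (Y.presheaf.stalk q) Ω[Y.presheaf.stalk q⁄A])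
    (hb : ∀ i, b i = KaehlerDifferential.D A _ (w i))
    (W : Module.Basis (Fin n) Y.functionField Ω[Y.functionField⁄A])
    (hW : ∀ i, W i = KaehlerDifferential.D A _ (toFunctionField q (w i)))
    -- relative coordinates at `Φ q`
    {w' : Fin n → Y.presheaf.stalk (Φ.base q)}
    (b' : Module.Basis (Fin n) (Y.presheaf.stalk (Φ.base q)) Ω[Y.presheaf.stalk (Φ.base q)⁄A])
    (hb' : ∀ i, b' i = KaehlerDifferential.D A _ (w' i))
    (W' : Module.Basis (Fin n) Y.functionField Ω[Y.functionField⁄A])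
    (hW' : ∀ i, W' i = KaehlerDifferential.D A _ (toFunctionField (Φ.base q) (w' i)))
    -- the top form `(f, u)` and its frame hypotheses
    (f : Y.functionField) {u : Fin n → Y.functionField}
    (B : Module.Basis (Fin n) Y.functionField Ω[Y.functionField⁄A])
    (hB : ∀ i, B i = KaehlerDifferential.D A _ (u i))
    (hq : IsUnitAt q (f * W.det B)) (hq' : IsUnitAt (Φ.base q) (f * W'.det B)) :
    IsUnitAt q (functionFieldMap Φ f *
      B.det (fun i => KaehlerDifferential.D A _ (functionFieldMap Φ (u i))) * f⁻¹) := by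
  classical
  set σ := functionFieldMap Φ with hσ
  -- (1) transport the coordinates at `Φ q` to `q`
  obtain ⟨b'', hb'', hff⟩ := exists_localCoordinates_of_isIso_stalkMap Φ n A q hA b' hb'
  obtain ⟨W'', hW''⟩ := exists_basis_functionField_of_localCoordinates' n A b'' hb''
  have hW''σ : ∀ i, W'' i = KaehlerDifferential.D A _ (σ (toFunctionField (Φ.base q) (w' i))) :=
    fun i => by rw [hW'', hff]
  -- (2) chain rule along `σ`: `W''.det (d σ v) = σ (W'.det (d v))`
  have hchain : ∀ v : Fin n → Y.functionField,
      W''.det (fun j => KaehlerDifferential.D A _ (σ (v j))) =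
        σ (W'.det fun j => KaehlerDifferential.D A _ (v j)) := fun v =>
    det_D_ringHom_eq (RingHom.id A) σ (by rw [hσA, RingHom.comp_id]) W' hW' W'' hW''σ v
  -- (3) the three units at `q`
  have hu1 : IsUnitAt q (σ (f * W'.det B)) := hq'.functionFieldMap
  have hu2 : IsUnitAt q (W.det W'') :=
    (isUnitAt_det_of_localCoordinates' n A b'' hb'' b hb hW'' hW).2
  have hu3 : IsUnitAt q (f * W.det B)⁻¹ := hq.inv
  -- (4) the algebra: `σ f · B.det (d σ u) · f⁻¹ = σ(f · W'.det B) · W.det W'' · (f · W.det B)⁻¹`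
  have hBσ : B.det (fun i => KaehlerDifferential.D A _ (σ (u i))) =
      B.det W'' * W''.det (fun i => KaehlerDifferential.D A _ (σ (u i))) := by
    rw [Module.Basis.det_apply, Module.Basis.det_apply, Module.Basis.det_apply, ← Matrix.det_mul,
      Module.Basis.toMatrix_mul_toMatrix]
  have hW'B : (fun j => KaehlerDifferential.D A Y.functionField (u j)) = ⇑B := funext fun j => (hB j).symm
  have hdet1 : W''.det (fun i => KaehlerDifferential.D A _ (σ (u i))) = σ (W'.det B) := by
    rw [hchain u, hW'B]
  have hBW'' : B.det W'' = B.det W * W.det W'' := by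
    rw [Module.Basis.det_apply, Module.Basis.det_apply, Module.Basis.det_apply, ← Matrix.det_mul,
      Module.Basis.toMatrix_mul_toMatrix]
  have hWB : W.det B * B.det W = 1 := by
    rw [Module.Basis.det_apply, Module.Basis.det_apply, ← Matrix.det_mul,
      Module.Basis.toMatrix_mul_toMatrix, Module.Basis.toMatrix_self, Matrix.det_one]
  have hf0 : f ≠ 0 := fun h0 => by
    rw [h0, zero_mul] at hq; exact hq.ne_zero rfl
  have key : σ f * B.det (fun i => KaehlerDifferential.D A _ (σ (u i))) * f⁻¹ =
      σ (f * W'.det B) * W.det W'' * (f * W.det B)⁻¹ := by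
    rw [hBσ, hdet1, hBW'', map_mul, mul_inv]
    have hBW : B.det W = (W.det B)⁻¹ := eq_inv_of_mul_eq_one_right hWB
    rw [hBW]
    ring
  rw [key]
  exact (hu1.mul hu2).mul hu3

end Literature.AlgebraicGeometry.Motives

end
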